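import Summits.QuantumFields.YangMills.Theorems.BalabanUVNodesN16H7TightWindow
import Literature.MathematicalPhysics.QuantumFieldTheory.Balaban1983to89.Node00.CarriersZ
import HarnessLib

/-!
# Route «BalabanUVNodes» (K3⁷ `SpineGivenEndpointR13SepCoPH`, stmt-QuantumFields-20544), DAG node N16 = NE3 — THE N07 → N16 EDGE `h7` KEYED TO NODE N07's SLOT OF
# RECORD: `DagBinding.B11Leaf (Node00.Z11OfRecord F N ζ)` ⟹ (modulo ONE displayed transfer (0.4) → (42) at the `Thm1At` level) N16's leaf `h7′` on loose data, and
# — with the tight-window leaf — `stub_h7`'s literal statement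

Cell `pub-ymgap`, width seat `pub-ymgap-dag-n16-w1`, generation 0, file 3 — HAND-OUT «w1 take X» of width seat `pub-ymgap-dag-n16-w3` (pub-ymgap INBOX l.25020,
2026-08-27; the `Thm1At`-LEVEL twin of its `BalabanUVNodesN16AveragingPin.Transfer04to42`, p584628), over files 1–2 of this seat (`BalabanUVNodesN16H7OfReg9` p584527,
`BalabanUVNodesN16H7TightWindow` p586490) and NODE 00's carrier module `Node00/CarriersZ` (node00-def g30: the [B11] bundle of record `Z11OfRecord F N ζ`, whose leaf's
`t1` conjunct is Theorem 1 AT NODE 00's OBJECTS over print's whole family index, `Node00.exists_thm1At_of_b11Leaf_Z11OfRecord`).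
`--supports stmt-QuantumFields-20544 --as helper` (count-neutral; kind = definition: two `def`s).  `bears_on: R4∕N16 · edge N07 → N16`.

THE POINT.  Node N07's SLOT OF RECORD is `h07 : B11Leaf (Z11OfRecord F N ζ)` (`Thm/BalabanUVNodesN07AtRecord13Co.lean`): [Balaban1985Variational] typed over NODE 00's objects —
torus sections `GaugeField (F.P K) 0 (SU N)`, the averaging OF RECORD `Node00.avOfRecord` ([Balaban1987RG1] (0.4)), print's (2)-class `Node00.InUkClassB11` (WITH the current
clause), `IsBackground`, the residual regularity data `RegCarrierT` (n07-a `B11Thm1CarrierT.varProblemT`).  Node N16's leaf `h7` lives at the NE3 objects — `ℤ⁴`-periodic lifts,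
[Balaban1985Averaging] (42)∕(43) (`avgIter`), the plaquette-only class `sfClass`, `IsMinimiser`, `RegularSup` — where «Theorem 1» is leaf-06's `Thm1At C (torusVP …)` (files 1–2).
Between the two sits [Balaban1987RG1] p. 253∕254's universality CLAIM («the considerations and results … are valid universally for all averages satisfying the above properties …
all results of the paper [12] are valid for it. The proofs are in most cases unchanged») — proved nowhere in print AS A THEOREM and nowhere in the tree (dag-n16-e's
`LOCATED-NE3-PIN-AVERAGING.md` R3; dag-n16-w3's `Transfer04to42` at the `H7Body` level).  THIS FILE names that claim AT THE `Thm1At` LEVEL as ONE displayed hypothesis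
(`Thm1AtTransfer04to42`) and closes the edge BY NAME: N07's slot ⟹ `h7′` (loose data) ⟹ (+ tight-window leaf) `stub_h7`.

WHAT THIS FILE DECLARES ∕ PROVES (0 sorry).
* §1 `lipGauge` (def) — the (9)_{β₀=1} SUP local-gauge shape on the cube `box K y` (file 1's written-out lambda, NAMED so that the transfer can cite the torus instance it
  feeds): «a unitary gauge `u` and a potential `a` with `U^u = exp a`, `‖a‖ ≤ α₀`, `‖∇a‖ ≤ α₁`, `‖∇∇a‖ ≤ α₂` on `box K y`»; `lipGauge_iff` (`Iff.rfl`); `radiiMono_lipGauge'` ∕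
  `interface_lipGauge'` (file 1's `radiiMono_lipGauge` ∕ `interface_lipGauge` BY NAME — the interface binders of files 1–2 §3 hold for it); `lipGauge_flat` (non-vacuity: the flat
  configuration, `u = 1`, `a = 0`, radii `0`).
* §2 `Thm1AtTransfer04to42 F N ζ B` (def, a `Prop`; asserted for nothing) — «Theorem 1 at NODE 00's (0.4)-objects over the whole family index (EXACTLY the conclusion of
  `Node00.exists_thm1At_of_b11Leaf_Z11OfRecord`) ⟹ Theorem 1 for leaf-06's (42)-torus instances at the record's NE3 letters (`torusVP 4 F.L (ne3NperOfRecord₁₁ F 0 0) lipGauge (k+1)`,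
  all `k`) with constants `C'` such that `C'.B₃ ≤ B` (the transferred (8)-radius constant is named OUTSIDE the `∃`, so that the loose∕tight split radius `ε∕B` is a letter) and
  `M(e) ≥ 7∕2` on `]0, a₁]` (the cube-size floor of files 1–2)»; `thm1AtTransfer04to42_iff` (`Iff.rfl`).
* §3 ★ `h7Shape_loose_of_b11Leaf_Z11OfRecord_of_transfer` — `B11Leaf (Z11OfRecord F N ζ)` → `Thm1AtTransfer04to42 F N ζ B` → `∃ C ε₀, 0 ≤ C ∧ 0 < ε₀ ∧ ∀ ε ∈ ]0,ε₀],
  LeafH3sup 4 F.L Nper ε (Cε) (Cε) {V ∈ ne3DomOfRecord₁₁ F N 0 0 | V ∈ sfClass 4 F.L Nper (ε∕B) 0}` (N07's slot ⟹ N16's `h7′`, by name: `exists_thm1At_of_b11Leaf_Z11OfRecord`, the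
  transfer, file 1 `leafH3sup_loose_of_thm1At_torusVP`, `MinimalActionDictionary.sfClass_mono` for `ε∕B ≤ ε∕C'.B₃`);
  ★ `h7_at_record_of_b11Leaf_Z11OfRecord_of_transfer_of_tightLeaf` — the same two hypotheses ∧ THE TIGHT-WINDOW LEAF at split radius `ε∕B` (file 2's AP-N16-2, displayed)
  ⟹ `stub_h7 F`'s LITERAL statement (dag-n16-e's evidence #6), via file 2 `leafH3sup_of_loose_of_tight` (far data vacuous by [B7] Prop. 2, proved).

LOCATED — WHAT THE TRANSFER HIDES (said, not adjudicated; each a reason it is a HYPOTHESIS and not a lemma).  (i) dag-n16-w3's (m1)–(m3) (`Transfer04to42` docstring):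
objects (0.4)∕torus sections vs (42)∕`ℤ⁴` lifts (`liftCfgOfRecord₁₁`), `IsBackground` (minimum over print's space, NODE 00's reading) vs `IsMinimiser` (global minimum over
`admissible`), the two AVERAGING MAPS differ at first order (dag-n16-e (E3)); (ii) THIS SEAT's A1 (evidence #9∕#14): `varProblemT.InU := Node00.InUkClassB11` IS print's space (2)
WITH the current clause «|(D*_U∂U)(b)| < ε₀L^{−2j}(Lʲη)^{−1}», whereas `torusVP.InU := sfClass` is the PLAQUETTE-ONLY closed class (leaf-06 D-s3-1) — so the transfer's
consequent speaks of plaquette-only-class minimisers and the a-priori item AP-N16-1 («such minimisers lie in print's (6)(a₀)») rides INSIDE the transfer; (iii) regularity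
readings: `RegCarrierT`'s four gauge-FIXED residual norm functionals (n07-a F8) vs `torusVP`'s least-common-factor device `Ψ` over the ∃u-shape `lipGauge`; (iv) the two side
letters `B`, `7∕2` are conveniences of the (42)-side consumer, not print's.  What the transfer does NOT hide: the tight-window item AP-N16-2 (kept as its own displayed leaf).

HONEST FRAMING.  Definitions (2) + bookkeeping over landed theorems BY NAME; NOTHING of Bałaban asserted — `B11Leaf (Z11OfRecord F N ζ)` (node N07's slot: Theorem 1 at
`k ≥ 1` = GAPS G₈a-1∕2, proved nowhere; closable-and-refutable by junk residual data per `Node00.exists_residZ_not_b11Leaf`, so only its ∃-form is meaningful), the transfer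
([I] p.253∕254's claim) and the tight-window leaf are DISPLAYED hypotheses; `stub_h7` NOT closed; N16 ∕ N07 NOT discharged; count-neutral; counts of record unmoved (typed 28∕28 ·
discharged 5∕27); one finite four-torus at fixed `ε`, Bałaban AS PRINTED — NOT ℝ⁴, NOT infinite volume, NOT OS, NOT a mass gap; the YM mass gap (Clay) is NOT proved by any of this —
R4 closes the conditional finite-𝕋⁴ rung `BalabanLadder.UV` only.
-/

set_option autoImplicit false

open scoped BigOperators Matrix Matrix.Norms.L2Operator
open NormedSpace

namespace Summit.QuantumFields.YangMills.BalabanUVNodes.N16H7OfN07RecordSlot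

open Literature.MathematicalPhysics.QuantumFieldTheory.Balaban1983to89
open B7Prop1Explicit B7Prop2Explicit MatrixLog UnitaryModel
open T4AveragingDeficitWall hiding Site Plane Plaq Bond
open T4AveragingDeficitWallBoundary (IsPeriodicCfg)
open T4Continuum (T4Family)
open Summit.QuantumFields.BalabanUV.T4Continuum
open AveragingDeficitLatticeH2Prep (fd)
open MinimalActionSandwich (IsMinimiser)
open MinimalActionRate (sfClass)
open MinimalActionRefine (RegularSup)
open MinimalActionDictionary (torusVP RadiiMono sfClass_mono)
open NE3.LeafIndexSockets (LeafH3sup)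
open B11Thm1 (Thm1At)
open B11Thm1CarrierT (varProblemT)
open DagBinding (B11Leaf)
open Node00 (ne3NperOfRecord₁₁ ne3DomOfRecord₁₁ MatA ZIdx ResidZ Z11OfRecord exists_thm1At_of_b11Leaf_Z11OfRecord)
open Summit.QuantumFields.YangMills.BalabanUVNodes.N16H7OfReg9 (leafH3sup_mono leafH3sup_anti leafH3sup_loose_of_thm1At_torusVP radiiMono_lipGauge
  interface_lipGauge)
open Summit.QuantumFields.YangMills.BalabanUVNodes.N16H7TightWindow (leafH3sup_of_loose_of_tight)

noncomputable section

/-! ## §1 The (9)_{β₀=1} sup local-gauge shape on cubes, named -/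

section Shape

variable {d : ℕ} {n : Type} [Fintype n] [DecidableEq n]

variable (d n) in
/-- **THE (9)_{β₀=1} SUP LOCAL-GAUGE SHAPE ON THE CUBE `box K y`** (file 1's written-out lambda, named): there are a unitary site gauge `u` and a potential `a` with
`U^u(z,τ) = exp a(z,τ)`, `‖a(z,τ)‖ ≤ α₀`, `‖∇_i a_τ(z)‖ ≤ α₁` and `‖∇_i∇_l a_τ(z)‖ ≤ α₂` for every site `z ∈ box K y` — [Balaban1985Variational] Thm 1 (9) TYPE («|A|, |∇^ηA|,
‖A‖_{1,β₀=1}» for the lattice potential `a = ηA`, Theorem 1 (9) p. 279) read on one cube; a SHAPE of ours (asserted for no configuration), the `G`-slot of leaf-06's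
`MinimalActionDictionary.torusVP`; context [Balaban1985Variational] Thm 1 (9) p. 279. [folklore] -/
@[folklore]
def lipGauge (U : Site d → Fin d → (Matrix n n ℂ)ˣ) (y : Site d) (K : ℕ) (α₀ α₁ α₂ : ℝ) : Prop :=
  ∃ (u : Site d → (Matrix n n ℂ)ˣ) (a : Site d → Fin d → Matrix n n ℂ), (∀ z, u z ∈ unitaryUnits (Matrix n n ℂ)) ∧
    (∀ (z : Site d) (τ : Fin d), z ∈ box K y → ((gaugeAct u U z τ : (Matrix n n ℂ)ˣ) : Matrix n n ℂ) = exp (a z τ)) ∧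
    (∀ (z : Site d) (τ : Fin d), z ∈ box K y → ‖a z τ‖ ≤ α₀) ∧
    (∀ (z : Site d) (τ i : Fin d), z ∈ box K y → ‖fd i (fun w => a w τ) z‖ ≤ α₁) ∧
    (∀ (z : Site d) (τ i l : Fin d), z ∈ box K y → ‖fd i (fd l (fun w => a w τ)) z‖ ≤ α₂)

/-- `lipGauge` unfolds to its body. [folklore] -/
theorem lipGauge_iff (U : Site d → Fin d → (Matrix n n ℂ)ˣ) (y : Site d) (K : ℕ) (α₀ α₁ α₂ : ℝ) :
    lipGauge d n U y K α₀ α₁ α₂ ↔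
      ∃ (u : Site d → (Matrix n n ℂ)ˣ) (a : Site d → Fin d → Matrix n n ℂ), (∀ z, u z ∈ unitaryUnits (Matrix n n ℂ)) ∧
        (∀ (z : Site d) (τ : Fin d), z ∈ box K y → ((gaugeAct u U z τ : (Matrix n n ℂ)ˣ) : Matrix n n ℂ) = exp (a z τ)) ∧
        (∀ (z : Site d) (τ : Fin d), z ∈ box K y → ‖a z τ‖ ≤ α₀) ∧
        (∀ (z : Site d) (τ i : Fin d), z ∈ box K y → ‖fd i (fun w => a w τ) z‖ ≤ α₁) ∧
        (∀ (z : Site d) (τ i l : Fin d), z ∈ box K y → ‖fd i (fd l (fun w => a w τ)) z‖ ≤ α₂) :=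
  Iff.rfl

/-- The shape is monotone in its radii (file 1 `radiiMono_lipGauge`, BY NAME). [folklore] -/
theorem radiiMono_lipGauge' : RadiiMono d (lipGauge d n) := radiiMono_lipGauge

/-- On a cube `box K x` with `K ≥ 2` the shape supplies the per-site gauge data of files 1–2 §3 at the centre `x` (file 1 `interface_lipGauge`, BY NAME). [folklore] -/
theorem interface_lipGauge' (U : Site d → Fin d → (Matrix n n ℂ)ˣ) (x : Site d) (K : ℕ) (α₀ α₁ α₂ : ℝ) (hK : 2 ≤ K) (h : lipGauge d n U x K α₀ α₁ α₂) :
    ∃ (u : Site d → (Matrix n n ℂ)ˣ) (a : Site d → Fin d → Matrix n n ℂ),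
      (∀ z, u z ∈ unitaryUnits (Matrix n n ℂ)) ∧
      (∀ (y : Site d) (τ : Fin d), l1 (y - x) ≤ 2 → ((gaugeAct u U y τ : (Matrix n n ℂ)ˣ) : Matrix n n ℂ) = exp (a y τ)) ∧
      (∀ (y : Site d) (τ : Fin d), l1 (y - x) ≤ 2 → ‖a y τ‖ ≤ α₀) ∧
      (∀ (y : Site d) (τ i : Fin d), l1 (y - x) ≤ 1 → ‖fd i (fun z => a z τ) y‖ ≤ α₁) ∧
      (∀ (τ i l : Fin d), ‖fd i (fd l (fun z => a z τ)) x‖ ≤ α₂) :=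
  interface_lipGauge U x K α₀ α₁ α₂ hK h

/-- NON-VACUITY: the flat configuration is in the shape on every cube with all radii `0` (`u = 1`, `a = 0`). [folklore] -/
theorem lipGauge_flat (y : Site d) (K : ℕ) : lipGauge d n (fun (_ : Site d) (_ : Fin d) => (1 : (Matrix n n ℂ)ˣ)) y K 0 0 0 := by
  refine ⟨fun _ => 1, fun _ _ => 0, fun _ => (unitaryUnits (Matrix n n ℂ)).one_mem, fun z τ _ => ?_, fun _ _ _ => by simp,
    fun _ _ _ _ => by simp [fd], fun _ _ _ _ _ => by simp [fd]⟩
  simp [gaugeAct]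

end Shape

/-! ## §2 The transfer (0.4) → (42) at the `Thm1At` level — ONE displayed hypothesis -/

section Transfer

variable (F : T4Family) (N : ℕ) [NeZero N]

/-- **THE AVERAGING TRANSFER (0.4) → (42) AT THE `Thm1At` LEVEL** (a `Prop`; asserted for NOTHING — [Balaban1987RG1] p. 253∕254's universality claim «all results of the
paper [12] are valid for it … valid universally for all averages» specialised to [Balaban1985Variational] Theorem 1, stated between the tree's two typings of that theorem).
ANTECEDENT = Theorem 1 AT NODE 00's (0.4)-OBJECTS over print's whole family index — EXACTLY the conclusion of `Node00.exists_thm1At_of_b11Leaf_Z11OfRecord`, i.e. what node N07's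
slot of record `B11Leaf (Z11OfRecord F N ζ)` delivers (`varProblemT`: torus sections, `avOfRecord`, the (2)-class `InUkClassB11` WITH current clause, `IsBackground`, residual
regularity data `ζ.R`).  CONSEQUENT = Theorem 1 FOR leaf-06's (42)-TORUS INSTANCES at node N16's record letters (`d = 4`, `L = F.L`, `Nper = ne3NperOfRecord₁₁ F 0 0`, the local-gauge
shape `lipGauge`, every run `k+1`) with constants `C'` whose (8)-radius constant is AT MOST the displayed letter `B` and whose cube-size bound satisfies `M(e) ≥ 7∕2` on `]0, a₁]`
(the two side letters files 1–2 consume).  WHAT IT HIDES: module header, LOCATED (i)–(iv) — in particular this seat's A1 (plaquette-only class on the (42) side) rides inside it.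
PRINT's CLAIM located as a DISPLAYED HYPOTHESIS SHAPE between two typings of the tree (context: [Balaban1987RG1] pp. 253–254, [Balaban1985Variational] Thm 1 p. 279); no comparison
theorem between (0.4)- and (42)-constrained minimisers is in print or in the tree. [folklore] -/
@[folklore]
def Thm1AtTransfer04to42 (ζ : ResidZ F N) (B : ℝ) : Prop :=
  (∃ C : B11Thm1.Consts, ∀ i : ZIdx, Thm1At C (varProblemT F N i.K i.k (ζ.R i))) →
    ∃ C' : B11Thm1.Consts, C'.B₃ ≤ B ∧ (∀ e : ℝ, 0 < e → e ≤ C'.a₁ → 7 / 2 ≤ C'.Mfun e) ∧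
      ∀ k : ℕ, Thm1At C' (torusVP 4 F.L (ne3NperOfRecord₁₁ F 0 0) (lipGauge 4 (Fin N)) (k + 1))

/-- The transfer unfolds to its body. [folklore] -/
theorem thm1AtTransfer04to42_iff (ζ : ResidZ F N) (B : ℝ) :
    Thm1AtTransfer04to42 F N ζ B ↔
      ((∃ C : B11Thm1.Consts, ∀ i : ZIdx, Thm1At C (varProblemT F N i.K i.k (ζ.R i))) →
        ∃ C' : B11Thm1.Consts, C'.B₃ ≤ B ∧ (∀ e : ℝ, 0 < e → e ≤ C'.a₁ → 7 / 2 ≤ C'.Mfun e) ∧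
          ∀ k : ℕ, Thm1At C' (torusVP 4 F.L (ne3NperOfRecord₁₁ F 0 0) (lipGauge 4 (Fin N)) (k + 1))) :=
  Iff.rfl

end Transfer

/-! ## §3 Node N07's slot of record ⟹ node N16's `h7′` (loose data) ⟹ (+ tight-window leaf) `stub_h7` -/

section Edge

variable {N : ℕ} [NeZero N]

/-- **★ NODE N07's SLOT OF RECORD ⟹ NODE N16's LEAF ON LOOSE DATA, BY NAME, MODULO THE TRANSFER.**  From `B11Leaf (Z11OfRecord F N ζ)` (N07's `h07`), the transfer
`Thm1AtTransfer04to42 F N ζ B` (any letter `B`; the transferred (8)-constant is `≤ B`): `∃ C ε₀, 0 ≤ C ∧ 0 < ε₀ ∧ ∀ ε ∈ ]0,ε₀], LeafH3sup 4 F.L Nper ε (Cε) (Cε) {V ∈ ne3DomOfRecord₁₁ F N 0 0 | V ∈ sfClass 4 F.L Nper (ε∕B) 0}`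
(`Nper = ne3NperOfRecord₁₁ F 0 0`; `C = 16937`, `ε₀ = min(C'.B₃·C'.a₁, 1∕28)` for the transferred constants `C'`).  Chain: `Node00.exists_thm1At_of_b11Leaf_Z11OfRecord` ∘ transfer ∘
file 1 `leafH3sup_loose_of_thm1At_torusVP` (interface binders by `radiiMono_lipGauge'` ∕ `interface_lipGauge'`) ∘ `sfClass_mono` (`ε∕B ≤ ε∕C'.B₃`).  Nothing of Bałaban asserted:
both hypotheses displayed. [cite: Balaban1985Variational, Thm 1 (8)–(10) p.279] -/
theorem h7Shape_loose_of_b11Leaf_Z11OfRecord_of_transfer (F : T4Family) {ζ : ResidZ F N} (h07 : B11Leaf (Z11OfRecord F N ζ))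
    {B : ℝ} (hT : Thm1AtTransfer04to42 F N ζ B) :
    ∃ C ε₀ : ℝ, 0 ≤ C ∧ 0 < ε₀ ∧ ∀ ε : ℝ, 0 < ε → ε ≤ ε₀ →
      LeafH3sup 4 F.L (ne3NperOfRecord₁₁ F 0 0) ε (C * ε) (C * ε)
        {V | V ∈ ne3DomOfRecord₁₁ F N 0 0 ∧ V ∈ sfClass 4 F.L (ne3NperOfRecord₁₁ F 0 0) (ε / B) 0} := by
  obtain ⟨C', hB₃, hM, hThm⟩ := hT (exists_thm1At_of_b11Leaf_Z11OfRecord h07)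
  have hL1 : 1 ≤ F.L := le_of_lt F.hL.2
  refine ⟨16937, min (C'.B₃ * C'.a₁) (1 / 28), by norm_num, lt_min (mul_pos C'.B₃_pos C'.a₁_pos) (by norm_num), fun ε hε hεle => ?_⟩
  have h := leafH3sup_loose_of_thm1At_torusVP (d := 4) (n := Fin N) hL1 radiiMono_lipGauge'
    (fun U x K α₀ α₁ α₂ hK hG => interface_lipGauge' U x K α₀ α₁ α₂ hK hG) C' hM hThm hε (hεle.trans (min_le_left _ _))
    (hεle.trans (min_le_right _ _)) (ne3DomOfRecord₁₁ F N 0 0)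
  refine leafH3sup_anti (leafH3sup_mono h (by nlinarith) le_rfl) ?_
  rintro V ⟨hV, hVl⟩
  have hεB : ε / B ≤ ε / C'.B₃ := div_le_div_of_nonneg_left hε.le C'.B₃_pos hB₃
  exact ⟨hV, sfClass_mono hεB hVl⟩

/-- **★ `stub_h7 F`'s LITERAL STATEMENT FROM NODE N07's SLOT OF RECORD, THE TRANSFER, AND THE TIGHT-WINDOW LEAF** (dag-n16-e's evidence #6 on stmt-QuantumFields-20544).
Hypotheses, all DISPLAYED: `h07 : B11Leaf (Z11OfRecord F N ζ)` (N07's slot), `hT : Thm1AtTransfer04to42 F N ζ B` ([I] p.253∕254 at the `Thm1At` level; hides A1), and the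
tight-window leaf at split radius `ε∕B` (`htight`, this seat's AP-N16-2: regularity of the plaquette-only-class minimisers whose datum has (7)-size in `]ε∕B, 4ε]` — NOT in
print).  Conclusion: `∃ C ε₀, 0 ≤ C ∧ 0 < ε₀ ∧ ∀ ε ∈ ]0,ε₀], LeafH3sup 4 F.L (ne3NperOfRecord₁₁ F 0 0) ε (Cε) (Cε) (ne3DomOfRecord₁₁ F N 0 0)`.  Chain: the loose part above, the
tight part the hypothesis, FAR data vacuous (file 2 `leafH3sup_of_loose_of_tight`, [Balaban1985Averaging] Prop. 2 proved). [cite: Balaban1985Variational, Thm 1 (8)–(10) p.279] -/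
theorem h7_at_record_of_b11Leaf_Z11OfRecord_of_transfer_of_tightLeaf (F : T4Family) {ζ : ResidZ F N} (h07 : B11Leaf (Z11OfRecord F N ζ))
    {B : ℝ} (hT : Thm1AtTransfer04to42 F N ζ B)
    (htight : ∃ Ct a : ℝ, 0 ≤ Ct ∧ 0 < a ∧ ∀ ε : ℝ, 0 < ε → ε ≤ a →
      LeafH3sup 4 F.L (ne3NperOfRecord₁₁ F 0 0) ε (Ct * ε) (Ct * ε)
        {V | V ∈ ne3DomOfRecord₁₁ F N 0 0 ∧ V ∉ sfClass 4 F.L (ne3NperOfRecord₁₁ F 0 0) (ε / B) 0 ∧ SmallField V (4 * ε)}) :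
    ∃ C ε₀ : ℝ, 0 ≤ C ∧ 0 < ε₀ ∧ ∀ ε : ℝ, 0 < ε → ε ≤ ε₀ →
      LeafH3sup 4 F.L (ne3NperOfRecord₁₁ F 0 0) ε (C * ε) (C * ε) (ne3DomOfRecord₁₁ F N 0 0) := by
  obtain ⟨Cl, εl, hCl, hεl, hloose⟩ := h7Shape_loose_of_b11Leaf_Z11OfRecord_of_transfer F h07 hT
  obtain ⟨Ct, a, hCt, ha, htight⟩ := htight
  have hL : 2 ≤ F.L := F.hL.2
  have hL1 : 1 ≤ F.L := by omega
  have hC0 := C0_pos 4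
  have hc2 := c2'_pos 4 F.L hL1
  refine ⟨max Cl Ct, min εl (min a (min (1 / (6 * C0 4)) (c2' 4 F.L / 4))), le_trans hCl (le_max_left _ _),
    lt_min hεl (lt_min ha (lt_min (by positivity) (by positivity))), fun ε hε hεle => ?_⟩
  have h1 : ε ≤ εl := hεle.trans (min_le_left _ _)
  have h2 : ε ≤ a := hεle.trans ((min_le_right _ _).trans (min_le_left _ _))
  have h3 : ε ≤ 1 / (6 * C0 4) := hεle.trans ((min_le_right _ _).trans ((min_le_right _ _).trans (min_le_left _ _)))
  have h4 : ε ≤ c2' 4 F.L / 4 := hεle.trans ((min_le_right _ _).trans ((min_le_right _ _).trans (min_le_right _ _)))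
  have hε3 : C0 4 * (2 * ε) ≤ 1 / 3 := by
    have : ε * (6 * C0 4) ≤ 1 := by rwa [le_div_iff₀ (by positivity)] at h3
    nlinarith
  have hε2 : 2 * (2 * ε) ≤ c2' 4 F.L := by linarith
  exact leafH3sup_of_loose_of_tight hL hε hε3 hε2 (δ := ε / B)
    (leafH3sup_mono (hloose ε hε h1) (mul_le_mul_of_nonneg_right (le_max_left _ _) hε.le) (mul_le_mul_of_nonneg_right (le_max_left _ _) hε.le))
    (leafH3sup_mono (htight ε hε h2) (mul_le_mul_of_nonneg_right (le_max_right _ _) hε.le) (mul_le_mul_of_nonneg_right (le_max_right _ _) hε.le))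

end Edge

end

end Summit.QuantumFields.YangMills.BalabanUVNodes.N16H7OfN07RecordSlot
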